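import Summits.QuantumFields.BalabanUV.T4Continuum.Support.OutputRateFunctionalTablesTermwiseEnds
import Summits.QuantumFields.BalabanUV.T4Continuum.Support.InsertionChannelEndArithmetic

/-!
# OutputRateFunctionalTablesTermwiseArithmetic — NE5 ∕ U3, ROAD D (owner R48-F ∕ R49): the TERMWISE ∕ FIBRE-CURRENCY ENDs of
# leaf-02-g17's `OutputRateFunctionalTablesTermwise` (part 4, p227801) and `OutputRateFunctionalTablesTermwiseEnds` (part 5, p229585)
# WITH THE ARITHMETIC LETTERS `ρ₀, k₀, B` AND THEIR FIVE BINDERS ELIMINATED — this lineage's `B13StepEndArithmetic.reach_elim_iff`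
# (p210647), `OutputRateArithmetic.reach_binders_exists` (p207722), `InsertionChannelEndArithmetic.rateWindow_nonempty_iff` (p219563)
# BY NAME; `∃ C₅` per slot package (`exists_…`) and the rate-window faces (`exists_rate_lt_one_…`)

Cell `pub-balaban`, unit `b2b-balaban-t4-ne5-formalise-leaf-10` (NE5 formalisation swarm, LEAF PROVER 10, gen 10; row O6-n NUMERICS =
leaves L10∕L11 of `SKELETON-NE5-P1`; lineage FOLLOWER under CLAIM RULE 1∕3 — the letters-free twin of NEW END faces carrying the five
arithmetic binders, this lineage's standing pattern: `B13StepEndArithmetic` p210647, `InsertionChannelEndArithmetic` p219563,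
`OutputRateTowerArithmetic` p220788, `InsertionChannelFamilyArithmetic` (this gen); journal INTENT in `CLAIMS.log`, leaf-02 lineage
named as the natural holder).  Imports part 5 (hence parts 1–4 and the owner's `OutputRateFunctionalTablesComplex`) +
`InsertionChannelEndArithmetic` (hence `B13StepEndArithmetic`, `OutputRateArithmetic`) ONLY; 0 `def`, 0 cite tag; Summits-side
bookkeeping under the LEAN PLACEMENT RULE (NOT a Literature module); nothing landed is edited — the ENDs and the arithmetic lemmas are
applied BY NAME.  HONEST FRAMING: rung (B)+1 of the FINITE-VOLUME T⁴ continuum programme — NOT infinite volume, NOT a mass gap, NOT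
the Clay problem, and **NOT A PROOF OF NE5** (NOT PRINTED; GAPS G-t4-U3-1): every END below is an IMPLICATION whose wall binders
(representation of the two runs' lifted function tables, admissibility, the pointwise class and its boxes, the pointwise TERMWISE
data — `HasSum` expansion, majorants, `TermBudget a G`, segment analyticity — or the pointwise no-room FIBRE envelopes (W2 in the
currency of E1 ∕ E8[rec] ∕ E9[rec]), the decay levels L05∕L06 — [Balaban1987RG1] (1.18) p. 263, SHAPE only —, W1 `hop`, W4 `hins`,
the insertion structure `InsAffine ∧ InsBlind ∧ InsHomog` with the pointwise single-scale bound (W3) or `InsertionDampedNat`, the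
rotation `hrot` and the real section `ι₀` of the complex chart) are DISPLAYED HYPOTHESES asserted nowhere.  HONEST DEPENDENCY (cell line,
verbatim): continuum YM on T⁴ ⇐ BetaPertH ∧ nine spine estimates (0/9 proved); BetaPertH ⇐ (D1) ∧ (D4) ∧ CAP+tail; G-an2-4 gates
asym, D1 and NE2/3/4.

THE POINT (decls, not adjectives).  Every Road-D END of the termwise ∕ fibre currency carries the reach `ρ₀ < 1`, the reach scale `k₀`
and the first-scales constant `B` with `hnear : (δ + δ′)·θ^{k₀} + c(EA₀ + E₀)∕(1 − ω) ≤ ρ₀`, `hB`, `hfirst`, and the `G`-form smallness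
`ω + G∕(1 − ρ₀)·c < θ′` — LITERALLY the five binders of this lineage's `B13StepEndArithmetic.arithmetic_letters_iff` (A5) with
`D := δ + δ′`, `cA := c`.  Hence they are jointly satisfiable IFF the TWO STRICT SIZE INEQUALITIES **`c·(EA₀ + E₀) < 1 − ω`** (REACH,
L10) and **`ω + G·c·(1 − ω)∕(1 − ω − c(EA₀ + E₀)) < θ′`** (SMALLNESS, L11) hold, and the rate window `θ ≤ θ′ < 1` is non-empty IFF
**`c·(G + EA₀ + E₀) < 1 − ω`** (`rateWindow_nonempty_iff`, A13) — on Road D exactly as on the carriers of record: the census VALUES of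
`B13SmallnessCensus.md` are unchanged (every letter O(1)-symbolic or not printed; 0∕12).

WHAT THIS FILE DOES ([folklore] bookkeeping; 0 sorry; axioms ⊆ {propext, Classical.choice, Quot.sound}).
* §1 part 4: `exists_ne5_of_familySlots_fibreCl` (fibre currency, `Gop`∕`Ghist`; smallness letter `Ghist`), `exists_ne5_of_familySlots_termwise`
  (THE (2.14)-ROADS' ROAD-D FACE) + its reach face `exists_rate_lt_one_of_familySlots_termwise` — the five binders over `ρ₀, k₀, B`
  REPLACED by `0 < θ < 1`, `ω < 1` and the two strict size inequalities (resp. the one window inequality); every other binder VERBATIM;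
  conclusion `∃ C₅, T4OutputRate.NE5 EA EB W κ θ′ C₅` (resp. `∃ θ′ < 1, θ ≤ θ′ ∧ ∃ C₅, …`) over the ORIGINAL carriers.
* §2 part 5, plain chart: `exists_ne5_of_familySlots_termwise_lip` (structure-free: `InsertionDampedNat`) + `exists_rate_lt_one_…`.
* §3 part 5, complex two-row chart `𝒰 × Fin 2` along a real section `ι₀`: `exists_ne5_of_familySlots_reIm_termwise` (structural),
  `exists_ne5_of_familySlots_reIm_termwise_lip` (structure-free) + `exists_rate_lt_one_of_familySlots_reIm_termwise_lip`.
NOT claimed: any estimate; any value of `G, c, ω, EA₀, E₀, δ, δ′`; that Bałaban's step satisfies a binder; NE5.  Headline wording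
(owner R30 (ii) ∕ R35, c5): «NE5 Road D termwise ENDs — arithmetic letters eliminated (junction bookkeeping)»; never «leaf
instantiated»; 0∕12; spine 0∕9.
-/

noncomputable section

open scoped BigOperators ENNReal
open Finset Function Metric Set Complex

namespace Summit.QuantumFields.BalabanUV.T4Continuum.OutputRateFunctionalTablesTermwiseArithmetic

open Literature.MathematicalPhysics.QuantumFieldTheory.Balaban1983to89
open Literature.MathematicalPhysics.QuantumFieldTheory.Balaban1983to89.T4OutputRate
open Literature.MathematicalPhysics.QuantumFieldTheory.Balaban1983to89.T4InputCauchyRateData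
open Literature.MathematicalPhysics.QuantumFieldTheory.Balaban1983to89.T4InputCauchyRateSpecies
open Literature.MathematicalPhysics.QuantumFieldTheory.Balaban1983to89.T4InputCauchyRateTermwise
open Summit.QuantumFields.BalabanUV.T4Continuum.OutputRateFunctionalTables
open Summit.QuantumFields.BalabanUV.T4Continuum.OutputRateFunctionalTablesFamily
open Summit.QuantumFields.BalabanUV.T4Continuum.OutputRateFunctionalTablesPointwise
open Summit.QuantumFields.BalabanUV.T4Continuum.OutputRateFunctionalTablesComplex
open Summit.QuantumFields.BalabanUV.T4Continuum.OutputRateFunctionalTablesTermwise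
open Summit.QuantumFields.BalabanUV.T4Continuum.OutputRateFunctionalTablesTermwiseEnds
open Summit.QuantumFields.BalabanUV.T4Continuum.OutputRateArithmetic (reach_binders_exists)
open Summit.QuantumFields.BalabanUV.T4Continuum.B13StepEndArithmetic (reach_elim_iff smallness_of_gain)
open Summit.QuantumFields.BalabanUV.T4Continuum.InsertionChannelEndArithmetic (rateWindow_nonempty_iff)

variable {C : Carriers} {𝒰 : Type} {Op Hist : Type*} [NormedAddCommGroup Op] [NormedSpace ℂ Op] [NormedAddCommGroup Hist]
  [NormedSpace ℂ Hist] {ι : Type*}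

/-! ## §1 ∕ §2 The termwise ∕ fibre-currency ENDs on a plain chart, letters eliminated -/

section Plain

variable (S : FamilySlots C 𝒰 Op Hist)

/-- [folklore] **PART 4's FIBRE-CURRENCY END OVER `C`, ARITHMETIC LETTERS ELIMINATED** — leaf-02-g17's
`FamilySlots.ne5_of_familySlots_fibreCl` (p227801 §5; pointwise no-room fibre envelopes `Gop` ∕ `Ghist`, species-resolved) with its FIVE
binders over `ρ₀, k₀, B` (`hρ₀`, `hnear`, `hB`, `hfirst`, the `G`-form smallness `ω + Ghist∕(1 − ρ₀)·c < θ′`) REPLACED by `0 < θ < 1`,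
`ω < 1` and the TWO STRICT SIZE INEQUALITIES `c(EA₀ + E₀) < 1 − ω`, `ω + Ghist·c·(1 − ω)∕(1 − ω − c(EA₀ + E₀)) < θ′`
(`B13StepEndArithmetic.reach_elim_iff` + `OutputRateArithmetic.reach_binders_exists` + `smallness_of_gain` BY NAME); every other binder
VERBATIM; `∃ C₅, NE5 EA EB W κ θ′ C₅` over the ORIGINAL carriers.  NOT a proof of NE5. -/
theorem exists_ne5_of_familySlots_fibreCl [Nonempty 𝒰] {ρ : 𝒰 → C.BgB} (hρ : Surjective ρ) {EA : Functional C C.BgA}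
    {EB : Functional C C.BgB} {W : Set (ℕ → ℝ)} {κ Gop Ghist EA₀ E₀ E₁ δ δ' θ θ' c ω : ℝ}
    (hrA : S.toStepModel.RepresentsA (liftA ρ EA) W) (hrB : S.toStepModel.RepresentsB (liftB ρ EB) W)
    (hbase : S.toStepModel.InBase (liftB ρ EB) W)
    (hopF : ∀ k, ∀ g ∈ W, ∀ p ∈ S.Base k g, ∀ (X : C.Dom) (w : 𝒰), C.scale X = k →
      ∀ h' ∈ closedBall (p.2 w) (S.rHist k), ∀ u : Op, ‖u‖ ≤ S.rOp k →
        DiffContOnCl ℂ (fun ζ : ℂ => S.Out k (p.1 w + ζ • u) h' (X, w)) (ball 0 1) ∧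
          ∀ ζ ∈ closedBall (0 : ℂ) 1, ‖S.Out k (p.1 w + ζ • u) h' (X, w)‖ ≤ Gop * Real.exp (-(κ * C.d X)))
    (hhistF : ∀ k, ∀ g ∈ W, ∀ p ∈ S.Base k g, ∀ (X : C.Dom) (w : 𝒰), C.scale X = k →
      ∀ o ∈ closedBall (p.1 w) (S.rOp k), ∀ v : Hist, ‖v‖ ≤ S.rHist k →
        DiffContOnCl ℂ (fun ζ : ℂ => S.Out k o (p.2 w + ζ • v) (X, w)) (ball 0 1) ∧
          ∀ ζ ∈ closedBall (0 : ℂ) 1, ‖S.Out k o (p.2 w + ζ • v) (X, w)‖ ≤ Ghist * Real.exp (-(κ * C.d X)))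
    (hdA : DecayBound EA W EA₀ κ) (hdB : DecayBound EB W E₀ κ)
    (hop : ∀ k, ∀ g ∈ W, ∀ u : 𝒰, ‖S.opA g k u - S.opB g k u‖ ≤ δ * θ ^ k * S.rOp k)
    (hins : ∀ k, ∀ g ∈ W, ∀ (t : C.Dom × 𝒰 → ℝ), (∀ Y u, |t (Y, u)| ≤ E₀ * Real.exp (-(κ * C.d Y))) →
      ∀ u, ‖S.insA g k t u - S.insB g k t u‖ ≤ δ' * θ ^ k * S.rHist k)
    (haff : S.toStepModel.InsAffine W) (hblind : S.toStepModel.InsBlind W) (hhom : S.toStepModel.InsHomog W)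
    (hunit : ∀ k, ∀ g ∈ W, ∀ (t : C.Dom × 𝒰 → ℝ) (j : ℕ), j < k → (∀ Y u, C.scale Y ≠ j → t (Y, u) = 0) →
      (∀ Y, C.scale Y = j → ∀ u, |t (Y, u)| ≤ E₁ * Real.exp (-(κ * C.d Y))) →
        ∀ u, ‖S.insA g k t u - S.insA g k 0 u‖ ≤ S.rHist k * (c * (ω ^ (k - 1 - j) * E₁)))
    (hE₁ : 0 < E₁) (hGop : 0 ≤ Gop) (hGhist : 0 ≤ Ghist) (hδ : 0 ≤ δ) (hδ' : 0 ≤ δ') (hθ0 : 0 < θ) (hθ1 : θ < 1) (hθθ' : θ ≤ θ')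
    (hθ'1 : θ' ≤ 1) (hc : 0 ≤ c) (hω : 0 < ω) (hω1 : ω < 1)
    (hh : c * (EA₀ + E₀) < 1 - ω) (hsmall : ω + Ghist * c * (1 - ω) / (1 - ω - c * (EA₀ + E₀)) < θ') :
    ∃ C₅, NE5 EA EB W κ θ' C₅ := by
  obtain ⟨ρ₀, hreach, hρ₀, hs⟩ := (reach_elim_iff (mul_nonneg hGhist hc) hω1).mpr ⟨hh, hsmall⟩
  obtain ⟨k₀, B, hB, hnear, hfirst⟩ := reach_binders_exists (add_nonneg hδ hδ') hθ0 hθ1 hreach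
  exact ⟨_, OutputRateFunctionalTablesTermwise.FamilySlots.ne5_of_familySlots_fibreCl S hρ hrA hrB hbase hopF hhistF hdA hdB hop
    hins haff hblind hhom hunit hE₁ hGop hGhist hδ hδ' hθ0.le hθθ' hθ'1 hc hω hρ₀ hnear hB hfirst (smallness_of_gain hs)⟩

/-- [folklore] **PART 4's TERMWISE END OVER `C` — THE (2.14)-ROADS' ROAD-D FACE — ARITHMETIC LETTERS ELIMINATED** —
leaf-02-g17's `FamilySlots.ne5_of_familySlots_termwise` (p227801 §5) with the five binders over `ρ₀, k₀, B` REPLACED by `0 < θ < 1`,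
`ω < 1`, `c(EA₀ + E₀) < 1 − ω` and `ω + G·c·(1 − ω)∕(1 − ω − c(EA₀ + E₀)) < θ′`; every other binder VERBATIM (representation of the
lifts, admissibility, the pointwise class with its boxes, pointwise termwise data `HasSum` ∕ majorants ∕ `TermBudget a G` ∕ segment
analyticity, decay levels, pointwise rates, insertion structure with the pointwise single-scale bound).  `∃ C₅, NE5 EA EB W κ θ′ C₅`. -/
theorem exists_ne5_of_familySlots_termwise [Nonempty 𝒰] {ρ : 𝒰 → C.BgB} (hρ : Surjective ρ) {EA : Functional C C.BgA}
    {EB : Functional C C.BgB} {W : Set (ℕ → ℝ)} {K : ℕ → (ℕ → ℝ) → 𝒰 → Set (Op × Hist)}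
    {T : ℕ → ι → Op → Hist → C.Dom × 𝒰 → ℂ} {a : ℕ → ι → ℝ} {κ G EA₀ E₀ E₁ δ δ' θ θ' c ω : ℝ}
    (hrA : S.toStepModel.RepresentsA (liftA ρ EA) W) (hrB : S.toStepModel.RepresentsB (liftB ρ EB) W)
    (hbase : S.toStepModel.InBase (liftB ρ EB) W)
    (hbox : ∀ k, ∀ g ∈ W, ∀ p ∈ S.Base k g, ∀ u : 𝒰,
      closedBall (p.1 u) (S.rOp k) ×ˢ closedBall (p.2 u) (S.rHist k) ⊆ K k g u)
    (hrep : ∀ k, ∀ g ∈ W, ∀ (u : 𝒰) (q : Op × Hist), q ∈ K k g u → ∀ X : C.Dom, C.scale X = k →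
      HasSum (fun i => T k i q.1 q.2 (X, u)) (S.Out k q.1 q.2 (X, u)))
    (hbd : ∀ k, ∀ g ∈ W, ∀ (u : 𝒰) (q : Op × Hist), q ∈ K k g u → ∀ X : C.Dom, C.scale X = k →
      ∀ i, ‖T k i q.1 q.2 (X, u)‖ ≤ a k i * Real.exp (-(κ * C.d X)))
    (hbud : TermBudget a G)
    (hline : ∀ k, ∀ g ∈ W, ∀ (w : 𝒰) (o u : Op) (h₀ v : Hist),
      (∀ ζ ∈ closedBall (0 : ℂ) 1, (o + ζ • u, h₀ + ζ • v) ∈ K k g w) → ∀ X : C.Dom, C.scale X = k →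
        ∀ i, DifferentiableOn ℂ (fun ζ : ℂ => T k i (o + ζ • u) (h₀ + ζ • v) (X, w)) (closedBall 0 1))
    (hdA : DecayBound EA W EA₀ κ) (hdB : DecayBound EB W E₀ κ)
    (hop : ∀ k, ∀ g ∈ W, ∀ u : 𝒰, ‖S.opA g k u - S.opB g k u‖ ≤ δ * θ ^ k * S.rOp k)
    (hins : ∀ k, ∀ g ∈ W, ∀ (t : C.Dom × 𝒰 → ℝ), (∀ Y u, |t (Y, u)| ≤ E₀ * Real.exp (-(κ * C.d Y))) →
      ∀ u, ‖S.insA g k t u - S.insB g k t u‖ ≤ δ' * θ ^ k * S.rHist k)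
    (haff : S.toStepModel.InsAffine W) (hblind : S.toStepModel.InsBlind W) (hhom : S.toStepModel.InsHomog W)
    (hunit : ∀ k, ∀ g ∈ W, ∀ (t : C.Dom × 𝒰 → ℝ) (j : ℕ), j < k → (∀ Y u, C.scale Y ≠ j → t (Y, u) = 0) →
      (∀ Y, C.scale Y = j → ∀ u, |t (Y, u)| ≤ E₁ * Real.exp (-(κ * C.d Y))) →
        ∀ u, ‖S.insA g k t u - S.insA g k 0 u‖ ≤ S.rHist k * (c * (ω ^ (k - 1 - j) * E₁)))
    (hE₁ : 0 < E₁) (hG : 0 ≤ G) (hδ : 0 ≤ δ) (hδ' : 0 ≤ δ') (hθ0 : 0 < θ) (hθ1 : θ < 1) (hθθ' : θ ≤ θ') (hθ'1 : θ' ≤ 1) (hc : 0 ≤ c)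
    (hω : 0 < ω) (hω1 : ω < 1)
    (hh : c * (EA₀ + E₀) < 1 - ω) (hsmall : ω + G * c * (1 - ω) / (1 - ω - c * (EA₀ + E₀)) < θ') :
    ∃ C₅, NE5 EA EB W κ θ' C₅ := by
  obtain ⟨ρ₀, hreach, hρ₀, hs⟩ := (reach_elim_iff (mul_nonneg hG hc) hω1).mpr ⟨hh, hsmall⟩
  obtain ⟨k₀, B, hB, hnear, hfirst⟩ := reach_binders_exists (add_nonneg hδ hδ') hθ0 hθ1 hreach
  exact ⟨_, OutputRateFunctionalTablesTermwise.FamilySlots.ne5_of_familySlots_termwise S hρ hrA hrB hbase hbox hrep hbd hbud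
    hline hdA hdB hop hins haff hblind hhom hunit hE₁ hG hδ hδ' hθ0.le hθθ' hθ'1 hc hω hρ₀ hnear hB hfirst (smallness_of_gain
    hs)⟩

/-- [folklore] **THE REACH FACE OF PART 4's TERMWISE END** — for EVERY input rate `0 < θ < 1`, `c·(G + EA₀ + E₀) < 1 − ω` gives SOME
`θ′ < 1` with `θ ≤ θ′` and `∃ C₅, NE5 EA EB W κ θ′ C₅`; no `ρ₀, k₀, B, θ′` left. -/
theorem exists_rate_lt_one_of_familySlots_termwise [Nonempty 𝒰] {ρ : 𝒰 → C.BgB} (hρ : Surjective ρ) {EA : Functional C C.BgA}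
    {EB : Functional C C.BgB} {W : Set (ℕ → ℝ)} {K : ℕ → (ℕ → ℝ) → 𝒰 → Set (Op × Hist)}
    {T : ℕ → ι → Op → Hist → C.Dom × 𝒰 → ℂ} {a : ℕ → ι → ℝ} {κ G EA₀ E₀ E₁ δ δ' θ c ω : ℝ}
    (hrA : S.toStepModel.RepresentsA (liftA ρ EA) W) (hrB : S.toStepModel.RepresentsB (liftB ρ EB) W)
    (hbase : S.toStepModel.InBase (liftB ρ EB) W)
    (hbox : ∀ k, ∀ g ∈ W, ∀ p ∈ S.Base k g, ∀ u : 𝒰,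
      closedBall (p.1 u) (S.rOp k) ×ˢ closedBall (p.2 u) (S.rHist k) ⊆ K k g u)
    (hrep : ∀ k, ∀ g ∈ W, ∀ (u : 𝒰) (q : Op × Hist), q ∈ K k g u → ∀ X : C.Dom, C.scale X = k →
      HasSum (fun i => T k i q.1 q.2 (X, u)) (S.Out k q.1 q.2 (X, u)))
    (hbd : ∀ k, ∀ g ∈ W, ∀ (u : 𝒰) (q : Op × Hist), q ∈ K k g u → ∀ X : C.Dom, C.scale X = k →
      ∀ i, ‖T k i q.1 q.2 (X, u)‖ ≤ a k i * Real.exp (-(κ * C.d X)))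
    (hbud : TermBudget a G)
    (hline : ∀ k, ∀ g ∈ W, ∀ (w : 𝒰) (o u : Op) (h₀ v : Hist),
      (∀ ζ ∈ closedBall (0 : ℂ) 1, (o + ζ • u, h₀ + ζ • v) ∈ K k g w) → ∀ X : C.Dom, C.scale X = k →
        ∀ i, DifferentiableOn ℂ (fun ζ : ℂ => T k i (o + ζ • u) (h₀ + ζ • v) (X, w)) (closedBall 0 1))
    (hdA : DecayBound EA W EA₀ κ) (hdB : DecayBound EB W E₀ κ)
    (hop : ∀ k, ∀ g ∈ W, ∀ u : 𝒰, ‖S.opA g k u - S.opB g k u‖ ≤ δ * θ ^ k * S.rOp k)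
    (hins : ∀ k, ∀ g ∈ W, ∀ (t : C.Dom × 𝒰 → ℝ), (∀ Y u, |t (Y, u)| ≤ E₀ * Real.exp (-(κ * C.d Y))) →
      ∀ u, ‖S.insA g k t u - S.insB g k t u‖ ≤ δ' * θ ^ k * S.rHist k)
    (haff : S.toStepModel.InsAffine W) (hblind : S.toStepModel.InsBlind W) (hhom : S.toStepModel.InsHomog W)
    (hunit : ∀ k, ∀ g ∈ W, ∀ (t : C.Dom × 𝒰 → ℝ) (j : ℕ), j < k → (∀ Y u, C.scale Y ≠ j → t (Y, u) = 0) →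
      (∀ Y, C.scale Y = j → ∀ u, |t (Y, u)| ≤ E₁ * Real.exp (-(κ * C.d Y))) →
        ∀ u, ‖S.insA g k t u - S.insA g k 0 u‖ ≤ S.rHist k * (c * (ω ^ (k - 1 - j) * E₁)))
    (hE₁ : 0 < E₁) (hG : 0 ≤ G) (hδ : 0 ≤ δ) (hδ' : 0 ≤ δ') (hθ0 : 0 < θ) (hθ1 : θ < 1) (hc : 0 ≤ c)
    (hω : 0 < ω) (hω1 : ω < 1)
    (h : c * (G + EA₀ + E₀) < 1 - ω) :
    ∃ θ' < 1, θ ≤ θ' ∧ ∃ C₅, NE5 EA EB W κ θ' C₅ := by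
  obtain ⟨hh, hs⟩ := (rateWindow_nonempty_iff hω1 hc hG).2 h
  obtain ⟨θ', h1, h2⟩ := exists_between (max_lt hθ1 hs)
  exact ⟨θ', h2, (le_max_left _ _).trans h1.le, exists_ne5_of_familySlots_termwise S hρ hrA hrB hbase hbox hrep hbd hbud hline
    hdA hdB hop hins haff hblind hhom hunit hE₁ hG hδ hδ' hθ0 hθ1 ((le_max_left _ _).trans h1.le) h2.le hc hω hω1 hh
    ((le_max_right _ _).trans_lt h1)⟩

/-- [folklore] **PART 5's STRUCTURE-FREE TERMWISE END OVER `C`, ARITHMETIC LETTERS ELIMINATED** — leaf-02-g17's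
`FamilySlots.ne5_of_familySlots_termwise_lip` (p229585 §1; `InsertionDampedNat` in place of the insertion structure) with the five
binders over `ρ₀, k₀, B` REPLACED by `0 < θ < 1`, `ω < 1` and the two strict size inequalities; every other binder VERBATIM.
`∃ C₅, NE5 EA EB W κ θ′ C₅` over the ORIGINAL carriers.  NOT a proof of NE5. -/
theorem exists_ne5_of_familySlots_termwise_lip [Nonempty 𝒰] {ρ : 𝒰 → C.BgB} (hρ : Surjective ρ) {EA : Functional C C.BgA}
    {EB : Functional C C.BgB} {W : Set (ℕ → ℝ)} {K : ℕ → (ℕ → ℝ) → 𝒰 → Set (Op × Hist)}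
    {T : ℕ → ι → Op → Hist → C.Dom × 𝒰 → ℂ} {a : ℕ → ι → ℝ} {κ G EA₀ E₀ δ δ' θ θ' c ω : ℝ}
    (hrA : S.toStepModel.RepresentsA (liftA ρ EA) W) (hrB : S.toStepModel.RepresentsB (liftB ρ EB) W)
    (hbase : S.toStepModel.InBase (liftB ρ EB) W)
    (hbox : ∀ k, ∀ g ∈ W, ∀ p ∈ S.Base k g, ∀ u : 𝒰,
      closedBall (p.1 u) (S.rOp k) ×ˢ closedBall (p.2 u) (S.rHist k) ⊆ K k g u)
    (hrep : ∀ k, ∀ g ∈ W, ∀ (u : 𝒰) (q : Op × Hist), q ∈ K k g u → ∀ X : C.Dom, C.scale X = k →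
      HasSum (fun i => T k i q.1 q.2 (X, u)) (S.Out k q.1 q.2 (X, u)))
    (hbd : ∀ k, ∀ g ∈ W, ∀ (u : 𝒰) (q : Op × Hist), q ∈ K k g u → ∀ X : C.Dom, C.scale X = k →
      ∀ i, ‖T k i q.1 q.2 (X, u)‖ ≤ a k i * Real.exp (-(κ * C.d X)))
    (hbud : TermBudget a G)
    (hline : ∀ k, ∀ g ∈ W, ∀ (w : 𝒰) (o u : Op) (h₀ v : Hist),
      (∀ ζ ∈ closedBall (0 : ℂ) 1, (o + ζ • u, h₀ + ζ • v) ∈ K k g w) → ∀ X : C.Dom, C.scale X = k →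
        ∀ i, DifferentiableOn ℂ (fun ζ : ℂ => T k i (o + ζ • u) (h₀ + ζ • v) (X, w)) (closedBall 0 1))
    (hdA : DecayBound EA W EA₀ κ) (hdB : DecayBound EB W E₀ κ)
    (hop : ∀ k, ∀ g ∈ W, ∀ u : 𝒰, ‖S.opA g k u - S.opB g k u‖ ≤ δ * θ ^ k * S.rOp k)
    (hins : ∀ k, ∀ g ∈ W, ∀ (t : C.Dom × 𝒰 → ℝ), (∀ Y u, |t (Y, u)| ≤ E₀ * Real.exp (-(κ * C.d Y))) →
      ∀ u, ‖S.insA g k t u - S.insB g k t u‖ ≤ δ' * θ ^ k * S.rHist k)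
    (hdamp : S.toStepModel.InsertionDampedNat W κ c ω)
    (hG : 0 ≤ G) (hδ : 0 ≤ δ) (hδ' : 0 ≤ δ') (hθ0 : 0 < θ) (hθ1 : θ < 1) (hθθ' : θ ≤ θ') (hθ'1 : θ' ≤ 1) (hc : 0 ≤ c)
    (hω : 0 < ω) (hω1 : ω < 1)
    (hh : c * (EA₀ + E₀) < 1 - ω) (hsmall : ω + G * c * (1 - ω) / (1 - ω - c * (EA₀ + E₀)) < θ') :
    ∃ C₅, NE5 EA EB W κ θ' C₅ := by
  obtain ⟨ρ₀, hreach, hρ₀, hs⟩ := (reach_elim_iff (mul_nonneg hG hc) hω1).mpr ⟨hh, hsmall⟩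
  obtain ⟨k₀, B, hB, hnear, hfirst⟩ := reach_binders_exists (add_nonneg hδ hδ') hθ0 hθ1 hreach
  exact ⟨_, OutputRateFunctionalTablesTermwiseEnds.FamilySlots.ne5_of_familySlots_termwise_lip S hρ hrA hrB hbase hbox hrep hbd
    hbud hline hdA hdB hop hins hdamp hG hδ hδ' hθ0.le hθθ' hθ'1 hc hω hρ₀ hnear hB hfirst (smallness_of_gain hs)⟩

/-- [folklore] **THE REACH FACE OF PART 5's STRUCTURE-FREE TERMWISE END** — for EVERY input rate `0 < θ < 1`, the ONE letter-free
inequality `c·(G + EA₀ + E₀) < 1 − ω` (this lineage's `InsertionChannelEndArithmetic.rateWindow_nonempty_iff`) gives SOME target rate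
`θ′ < 1` with `θ ≤ θ′` and `∃ C₅, NE5 EA EB W κ θ′ C₅`; no `ρ₀, k₀, B, θ′` left. -/
theorem exists_rate_lt_one_of_familySlots_termwise_lip [Nonempty 𝒰] {ρ : 𝒰 → C.BgB} (hρ : Surjective ρ) {EA : Functional C C.BgA}
    {EB : Functional C C.BgB} {W : Set (ℕ → ℝ)} {K : ℕ → (ℕ → ℝ) → 𝒰 → Set (Op × Hist)}
    {T : ℕ → ι → Op → Hist → C.Dom × 𝒰 → ℂ} {a : ℕ → ι → ℝ} {κ G EA₀ E₀ δ δ' θ c ω : ℝ}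
    (hrA : S.toStepModel.RepresentsA (liftA ρ EA) W) (hrB : S.toStepModel.RepresentsB (liftB ρ EB) W)
    (hbase : S.toStepModel.InBase (liftB ρ EB) W)
    (hbox : ∀ k, ∀ g ∈ W, ∀ p ∈ S.Base k g, ∀ u : 𝒰,
      closedBall (p.1 u) (S.rOp k) ×ˢ closedBall (p.2 u) (S.rHist k) ⊆ K k g u)
    (hrep : ∀ k, ∀ g ∈ W, ∀ (u : 𝒰) (q : Op × Hist), q ∈ K k g u → ∀ X : C.Dom, C.scale X = k →
      HasSum (fun i => T k i q.1 q.2 (X, u)) (S.Out k q.1 q.2 (X, u)))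
    (hbd : ∀ k, ∀ g ∈ W, ∀ (u : 𝒰) (q : Op × Hist), q ∈ K k g u → ∀ X : C.Dom, C.scale X = k →
      ∀ i, ‖T k i q.1 q.2 (X, u)‖ ≤ a k i * Real.exp (-(κ * C.d X)))
    (hbud : TermBudget a G)
    (hline : ∀ k, ∀ g ∈ W, ∀ (w : 𝒰) (o u : Op) (h₀ v : Hist),
      (∀ ζ ∈ closedBall (0 : ℂ) 1, (o + ζ • u, h₀ + ζ • v) ∈ K k g w) → ∀ X : C.Dom, C.scale X = k →
        ∀ i, DifferentiableOn ℂ (fun ζ : ℂ => T k i (o + ζ • u) (h₀ + ζ • v) (X, w)) (closedBall 0 1))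
    (hdA : DecayBound EA W EA₀ κ) (hdB : DecayBound EB W E₀ κ)
    (hop : ∀ k, ∀ g ∈ W, ∀ u : 𝒰, ‖S.opA g k u - S.opB g k u‖ ≤ δ * θ ^ k * S.rOp k)
    (hins : ∀ k, ∀ g ∈ W, ∀ (t : C.Dom × 𝒰 → ℝ), (∀ Y u, |t (Y, u)| ≤ E₀ * Real.exp (-(κ * C.d Y))) →
      ∀ u, ‖S.insA g k t u - S.insB g k t u‖ ≤ δ' * θ ^ k * S.rHist k)
    (hdamp : S.toStepModel.InsertionDampedNat W κ c ω)
    (hG : 0 ≤ G) (hδ : 0 ≤ δ) (hδ' : 0 ≤ δ') (hθ0 : 0 < θ) (hθ1 : θ < 1) (hc : 0 ≤ c)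
    (hω : 0 < ω) (hω1 : ω < 1)
    (h : c * (G + EA₀ + E₀) < 1 - ω) :
    ∃ θ' < 1, θ ≤ θ' ∧ ∃ C₅, NE5 EA EB W κ θ' C₅ := by
  obtain ⟨hh, hs⟩ := (rateWindow_nonempty_iff hω1 hc hG).2 h
  obtain ⟨θ', h1, h2⟩ := exists_between (max_lt hθ1 hs)
  exact ⟨θ', h2, (le_max_left _ _).trans h1.le, exists_ne5_of_familySlots_termwise_lip S hρ hrA hrB hbase hbox hrep hbd hbud
    hline hdA hdB hop hins hdamp hG hδ hδ' hθ0 hθ1 ((le_max_left _ _).trans h1.le) h2.le hc hω hω1 hh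
    ((le_max_right _ _).trans_lt h1)⟩


end Plain

/-! ## §3 The complex two-row chart ENDs along a real section, letters eliminated -/

section ComplexChart

variable (S : FamilySlots C (𝒰 × Fin 2) Op Hist) (Out₀ : ℕ → Op → Hist → C.Dom → ℂ)

/-- [folklore] **PART 5's COMPLEX-CHART TERMWISE END (STRUCTURAL) ALONG A REAL SECTION, ARITHMETIC LETTERS ELIMINATED** —
leaf-02-g17's `ne5_of_familySlots_reIm_termwise` (p229585 §2; family slots over the two-row chart `𝒰 × Fin 2` with the rotation
`hrot`, the owner's `ne5_of_ne5_reImTab` along `ι₀`) with the five binders over `ρ₀, k₀, B` REPLACED by `0 < θ < 1`, `ω < 1` and the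
two strict size inequalities; every other binder VERBATIM (incl. the section binders `ι₀`, `hιA`, `hιB` after the numerics).
`∃ C₅, NE5 EA EB W κ θ′ C₅`.  NOT a proof of NE5. -/
theorem exists_ne5_of_familySlots_reIm_termwise [Nonempty 𝒰] {ℰA ℰB : (ℕ → ℝ) → 𝒰 → C.Dom → ℂ} {EA : Functional C C.BgA}
    {EB : Functional C C.BgB} {W : Set (ℕ → ℝ)} {K : ℕ → (ℕ → ℝ) → 𝒰 × Fin 2 → Set (Op × Hist)}
    {T₀ : ℕ → ι → Op → Hist → C.Dom → ℂ} {a : ℕ → ι → ℝ} {κ G EA₀ E₀ E₁ δ δ' θ θ' c ω : ℝ}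
    (hrot : ∀ k o h p, S.Out k o h p = (-I) ^ (p.2.2 : ℕ) * Out₀ k o h p.1)
    (hrA : ∀ g ∈ W, ∀ (X : C.Dom) (u : 𝒰) (i : Fin 2), ℰA g u X =
      Out₀ (C.scale X) (S.opA g (C.scale X) (u, i)) (S.insA g (C.scale X) (tableA (reImTab (C := C) ℰA) g PUnit.unit) (u, i)) X)
    (hrB : ∀ g ∈ W, ∀ (X : C.Dom) (u : 𝒰) (i : Fin 2), ℰB g u X =
      Out₀ (C.scale X) (S.opB g (C.scale X) (u, i)) (S.insB g (C.scale X) (tableB (reImTab (C := C) ℰB) g PUnit.unit) (u, i)) X)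
    (hbase : ∀ k, ∀ g ∈ W, (S.opB g k, S.insB g k (tableB (reImTab (C := C) ℰB) g PUnit.unit)) ∈ S.Base k g)
    (hbox : ∀ k, ∀ g ∈ W, ∀ p ∈ S.Base k g, ∀ w : 𝒰 × Fin 2,
      closedBall (p.1 w) (S.rOp k) ×ˢ closedBall (p.2 w) (S.rHist k) ⊆ K k g w)
    (hrep : ∀ k, ∀ g ∈ W, ∀ (w : 𝒰 × Fin 2) (q : Op × Hist), q ∈ K k g w → ∀ X : C.Dom, C.scale X = k →
      HasSum (fun i => T₀ k i q.1 q.2 X) (Out₀ k q.1 q.2 X))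
    (hbd : ∀ k, ∀ g ∈ W, ∀ (w : 𝒰 × Fin 2) (q : Op × Hist), q ∈ K k g w → ∀ X : C.Dom, C.scale X = k →
      ∀ i, ‖T₀ k i q.1 q.2 X‖ ≤ a k i * Real.exp (-(κ * C.d X)))
    (hbud : TermBudget a G)
    (hline : ∀ k, ∀ g ∈ W, ∀ (w : 𝒰 × Fin 2) (o u : Op) (h₀ v : Hist),
      (∀ ζ ∈ closedBall (0 : ℂ) 1, (o + ζ • u, h₀ + ζ • v) ∈ K k g w) → ∀ X : C.Dom, C.scale X = k →
        ∀ i, DifferentiableOn ℂ (fun ζ : ℂ => T₀ k i (o + ζ • u) (h₀ + ζ • v) X) (closedBall 0 1))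
    (hdA : ∀ g ∈ W, ∀ (u : 𝒰) (X : C.Dom), ‖ℰA g u X‖ ≤ EA₀ * Real.exp (-(κ * C.d X)))
    (hdB : ∀ g ∈ W, ∀ (u : 𝒰) (X : C.Dom), ‖ℰB g u X‖ ≤ E₀ * Real.exp (-(κ * C.d X)))
    (hop : ∀ k, ∀ g ∈ W, ∀ w : 𝒰 × Fin 2, ‖S.opA g k w - S.opB g k w‖ ≤ δ * θ ^ k * S.rOp k)
    (hins : ∀ k, ∀ g ∈ W, ∀ (t : C.Dom × (𝒰 × Fin 2) → ℝ), (∀ Y w, |t (Y, w)| ≤ E₀ * Real.exp (-(κ * C.d Y))) →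
      ∀ w, ‖S.insA g k t w - S.insB g k t w‖ ≤ δ' * θ ^ k * S.rHist k)
    (haff : S.toStepModel.InsAffine W) (hblind : S.toStepModel.InsBlind W) (hhom : S.toStepModel.InsHomog W)
    (hunit : ∀ k, ∀ g ∈ W, ∀ (t : C.Dom × (𝒰 × Fin 2) → ℝ) (j : ℕ), j < k → (∀ Y w, C.scale Y ≠ j → t (Y, w) = 0) →
      (∀ Y, C.scale Y = j → ∀ w, |t (Y, w)| ≤ E₁ * Real.exp (-(κ * C.d Y))) →
        ∀ w, ‖S.insA g k t w - S.insA g k 0 w‖ ≤ S.rHist k * (c * (ω ^ (k - 1 - j) * E₁)))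
    (hE₁ : 0 < E₁) (hG : 0 ≤ G) (hδ : 0 ≤ δ) (hδ' : 0 ≤ δ') (hθ0 : 0 < θ) (hθ1 : θ < 1) (hθθ' : θ ≤ θ') (hθ'1 : θ' ≤ 1) (hc : 0 ≤ c)
    (hω : 0 < ω) (hω1 : ω < 1)
    (hh : c * (EA₀ + E₀) < 1 - ω) (hsmall : ω + G * c * (1 - ω) / (1 - ω - c * (EA₀ + E₀)) < θ')
    (ι₀ : C.BgB → 𝒰) (hιA : ∀ g ∈ W, ∀ (U : C.BgB) (X : C.Dom), EA g (C.transport U) X = (ℰA g (ι₀ U) X).re)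
    (hιB : ∀ g ∈ W, ∀ (U : C.BgB) (X : C.Dom), EB g U X = (ℰB g (ι₀ U) X).re) :
    ∃ C₅, NE5 EA EB W κ θ' C₅ := by
  obtain ⟨ρ₀, hreach, hρ₀, hs⟩ := (reach_elim_iff (mul_nonneg hG hc) hω1).mpr ⟨hh, hsmall⟩
  obtain ⟨k₀, B, hB, hnear, hfirst⟩ := reach_binders_exists (add_nonneg hδ hδ') hθ0 hθ1 hreach
  exact ⟨_, OutputRateFunctionalTablesTermwiseEnds.ne5_of_familySlots_reIm_termwise S Out₀ hrot hrA hrB hbase hbox hrep hbd hbud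
    hline hdA hdB hop hins haff hblind hhom hunit hE₁ hG hδ hδ' hθ0.le hθθ' hθ'1 hc hω hρ₀ hnear hB hfirst (smallness_of_gain
    hs) ι₀ hιA hιB⟩

/-- [folklore] **PART 5's COMPLEX-CHART TERMWISE END (STRUCTURE-FREE) ALONG A REAL SECTION, ARITHMETIC LETTERS ELIMINATED** —
leaf-02-g17's `ne5_of_familySlots_reIm_termwise_lip` (p229585 §2) with the five binders over `ρ₀, k₀, B` REPLACED by `0 < θ < 1`,
`ω < 1` and the two strict size inequalities; every other binder VERBATIM.  `∃ C₅, NE5 EA EB W κ θ′ C₅`.  NOT a proof of NE5. -/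
theorem exists_ne5_of_familySlots_reIm_termwise_lip [Nonempty 𝒰] {ℰA ℰB : (ℕ → ℝ) → 𝒰 → C.Dom → ℂ} {EA : Functional C C.BgA}
    {EB : Functional C C.BgB} {W : Set (ℕ → ℝ)} {K : ℕ → (ℕ → ℝ) → 𝒰 × Fin 2 → Set (Op × Hist)}
    {T₀ : ℕ → ι → Op → Hist → C.Dom → ℂ} {a : ℕ → ι → ℝ} {κ G EA₀ E₀ δ δ' θ θ' c ω : ℝ}
    (hrot : ∀ k o h p, S.Out k o h p = (-I) ^ (p.2.2 : ℕ) * Out₀ k o h p.1)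
    (hrA : ∀ g ∈ W, ∀ (X : C.Dom) (u : 𝒰) (i : Fin 2), ℰA g u X =
      Out₀ (C.scale X) (S.opA g (C.scale X) (u, i)) (S.insA g (C.scale X) (tableA (reImTab (C := C) ℰA) g PUnit.unit) (u, i)) X)
    (hrB : ∀ g ∈ W, ∀ (X : C.Dom) (u : 𝒰) (i : Fin 2), ℰB g u X =
      Out₀ (C.scale X) (S.opB g (C.scale X) (u, i)) (S.insB g (C.scale X) (tableB (reImTab (C := C) ℰB) g PUnit.unit) (u, i)) X)
    (hbase : ∀ k, ∀ g ∈ W, (S.opB g k, S.insB g k (tableB (reImTab (C := C) ℰB) g PUnit.unit)) ∈ S.Base k g)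
    (hbox : ∀ k, ∀ g ∈ W, ∀ p ∈ S.Base k g, ∀ w : 𝒰 × Fin 2,
      closedBall (p.1 w) (S.rOp k) ×ˢ closedBall (p.2 w) (S.rHist k) ⊆ K k g w)
    (hrep : ∀ k, ∀ g ∈ W, ∀ (w : 𝒰 × Fin 2) (q : Op × Hist), q ∈ K k g w → ∀ X : C.Dom, C.scale X = k →
      HasSum (fun i => T₀ k i q.1 q.2 X) (Out₀ k q.1 q.2 X))
    (hbd : ∀ k, ∀ g ∈ W, ∀ (w : 𝒰 × Fin 2) (q : Op × Hist), q ∈ K k g w → ∀ X : C.Dom, C.scale X = k →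
      ∀ i, ‖T₀ k i q.1 q.2 X‖ ≤ a k i * Real.exp (-(κ * C.d X)))
    (hbud : TermBudget a G)
    (hline : ∀ k, ∀ g ∈ W, ∀ (w : 𝒰 × Fin 2) (o u : Op) (h₀ v : Hist),
      (∀ ζ ∈ closedBall (0 : ℂ) 1, (o + ζ • u, h₀ + ζ • v) ∈ K k g w) → ∀ X : C.Dom, C.scale X = k →
        ∀ i, DifferentiableOn ℂ (fun ζ : ℂ => T₀ k i (o + ζ • u) (h₀ + ζ • v) X) (closedBall 0 1))
    (hdA : ∀ g ∈ W, ∀ (u : 𝒰) (X : C.Dom), ‖ℰA g u X‖ ≤ EA₀ * Real.exp (-(κ * C.d X)))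
    (hdB : ∀ g ∈ W, ∀ (u : 𝒰) (X : C.Dom), ‖ℰB g u X‖ ≤ E₀ * Real.exp (-(κ * C.d X)))
    (hop : ∀ k, ∀ g ∈ W, ∀ w : 𝒰 × Fin 2, ‖S.opA g k w - S.opB g k w‖ ≤ δ * θ ^ k * S.rOp k)
    (hins : ∀ k, ∀ g ∈ W, ∀ (t : C.Dom × (𝒰 × Fin 2) → ℝ), (∀ Y w, |t (Y, w)| ≤ E₀ * Real.exp (-(κ * C.d Y))) →
      ∀ w, ‖S.insA g k t w - S.insB g k t w‖ ≤ δ' * θ ^ k * S.rHist k)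
    (hdamp : S.toStepModel.InsertionDampedNat W κ c ω)
    (hG : 0 ≤ G) (hδ : 0 ≤ δ) (hδ' : 0 ≤ δ') (hθ0 : 0 < θ) (hθ1 : θ < 1) (hθθ' : θ ≤ θ') (hθ'1 : θ' ≤ 1) (hc : 0 ≤ c)
    (hω : 0 < ω) (hω1 : ω < 1)
    (hh : c * (EA₀ + E₀) < 1 - ω) (hsmall : ω + G * c * (1 - ω) / (1 - ω - c * (EA₀ + E₀)) < θ')
    (ι₀ : C.BgB → 𝒰) (hιA : ∀ g ∈ W, ∀ (U : C.BgB) (X : C.Dom), EA g (C.transport U) X = (ℰA g (ι₀ U) X).re)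
    (hιB : ∀ g ∈ W, ∀ (U : C.BgB) (X : C.Dom), EB g U X = (ℰB g (ι₀ U) X).re) :
    ∃ C₅, NE5 EA EB W κ θ' C₅ := by
  obtain ⟨ρ₀, hreach, hρ₀, hs⟩ := (reach_elim_iff (mul_nonneg hG hc) hω1).mpr ⟨hh, hsmall⟩
  obtain ⟨k₀, B, hB, hnear, hfirst⟩ := reach_binders_exists (add_nonneg hδ hδ') hθ0 hθ1 hreach
  exact ⟨_, OutputRateFunctionalTablesTermwiseEnds.ne5_of_familySlots_reIm_termwise_lip S Out₀ hrot hrA hrB hbase hbox hrep hbd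
    hbud hline hdA hdB hop hins hdamp hG hδ hδ' hθ0.le hθθ' hθ'1 hc hω hρ₀ hnear hB hfirst (smallness_of_gain hs) ι₀ hιA hιB⟩

/-- [folklore] **THE REACH FACE OF PART 5's STRUCTURE-FREE COMPLEX-CHART TERMWISE END** — for EVERY input rate `0 < θ < 1`,
`c·(G + EA₀ + E₀) < 1 − ω` gives SOME `θ′ < 1` with `θ ≤ θ′` and `∃ C₅, NE5 EA EB W κ θ′ C₅` along the real section; no
`ρ₀, k₀, B, θ′` left. -/
theorem exists_rate_lt_one_of_familySlots_reIm_termwise_lip [Nonempty 𝒰] {ℰA ℰB : (ℕ → ℝ) → 𝒰 → C.Dom → ℂ} {EA : Functional C C.BgA}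
    {EB : Functional C C.BgB} {W : Set (ℕ → ℝ)} {K : ℕ → (ℕ → ℝ) → 𝒰 × Fin 2 → Set (Op × Hist)}
    {T₀ : ℕ → ι → Op → Hist → C.Dom → ℂ} {a : ℕ → ι → ℝ} {κ G EA₀ E₀ δ δ' θ c ω : ℝ}
    (hrot : ∀ k o h p, S.Out k o h p = (-I) ^ (p.2.2 : ℕ) * Out₀ k o h p.1)
    (hrA : ∀ g ∈ W, ∀ (X : C.Dom) (u : 𝒰) (i : Fin 2), ℰA g u X =
      Out₀ (C.scale X) (S.opA g (C.scale X) (u, i)) (S.insA g (C.scale X) (tableA (reImTab (C := C) ℰA) g PUnit.unit) (u, i)) X)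
    (hrB : ∀ g ∈ W, ∀ (X : C.Dom) (u : 𝒰) (i : Fin 2), ℰB g u X =
      Out₀ (C.scale X) (S.opB g (C.scale X) (u, i)) (S.insB g (C.scale X) (tableB (reImTab (C := C) ℰB) g PUnit.unit) (u, i)) X)
    (hbase : ∀ k, ∀ g ∈ W, (S.opB g k, S.insB g k (tableB (reImTab (C := C) ℰB) g PUnit.unit)) ∈ S.Base k g)
    (hbox : ∀ k, ∀ g ∈ W, ∀ p ∈ S.Base k g, ∀ w : 𝒰 × Fin 2,
      closedBall (p.1 w) (S.rOp k) ×ˢ closedBall (p.2 w) (S.rHist k) ⊆ K k g w)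
    (hrep : ∀ k, ∀ g ∈ W, ∀ (w : 𝒰 × Fin 2) (q : Op × Hist), q ∈ K k g w → ∀ X : C.Dom, C.scale X = k →
      HasSum (fun i => T₀ k i q.1 q.2 X) (Out₀ k q.1 q.2 X))
    (hbd : ∀ k, ∀ g ∈ W, ∀ (w : 𝒰 × Fin 2) (q : Op × Hist), q ∈ K k g w → ∀ X : C.Dom, C.scale X = k →
      ∀ i, ‖T₀ k i q.1 q.2 X‖ ≤ a k i * Real.exp (-(κ * C.d X)))
    (hbud : TermBudget a G)
    (hline : ∀ k, ∀ g ∈ W, ∀ (w : 𝒰 × Fin 2) (o u : Op) (h₀ v : Hist),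
      (∀ ζ ∈ closedBall (0 : ℂ) 1, (o + ζ • u, h₀ + ζ • v) ∈ K k g w) → ∀ X : C.Dom, C.scale X = k →
        ∀ i, DifferentiableOn ℂ (fun ζ : ℂ => T₀ k i (o + ζ • u) (h₀ + ζ • v) X) (closedBall 0 1))
    (hdA : ∀ g ∈ W, ∀ (u : 𝒰) (X : C.Dom), ‖ℰA g u X‖ ≤ EA₀ * Real.exp (-(κ * C.d X)))
    (hdB : ∀ g ∈ W, ∀ (u : 𝒰) (X : C.Dom), ‖ℰB g u X‖ ≤ E₀ * Real.exp (-(κ * C.d X)))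
    (hop : ∀ k, ∀ g ∈ W, ∀ w : 𝒰 × Fin 2, ‖S.opA g k w - S.opB g k w‖ ≤ δ * θ ^ k * S.rOp k)
    (hins : ∀ k, ∀ g ∈ W, ∀ (t : C.Dom × (𝒰 × Fin 2) → ℝ), (∀ Y w, |t (Y, w)| ≤ E₀ * Real.exp (-(κ * C.d Y))) →
      ∀ w, ‖S.insA g k t w - S.insB g k t w‖ ≤ δ' * θ ^ k * S.rHist k)
    (hdamp : S.toStepModel.InsertionDampedNat W κ c ω)
    (hG : 0 ≤ G) (hδ : 0 ≤ δ) (hδ' : 0 ≤ δ') (hθ0 : 0 < θ) (hθ1 : θ < 1) (hc : 0 ≤ c)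
    (hω : 0 < ω) (hω1 : ω < 1)
    (h : c * (G + EA₀ + E₀) < 1 - ω)
    (ι₀ : C.BgB → 𝒰) (hιA : ∀ g ∈ W, ∀ (U : C.BgB) (X : C.Dom), EA g (C.transport U) X = (ℰA g (ι₀ U) X).re)
    (hιB : ∀ g ∈ W, ∀ (U : C.BgB) (X : C.Dom), EB g U X = (ℰB g (ι₀ U) X).re) :
    ∃ θ' < 1, θ ≤ θ' ∧ ∃ C₅, NE5 EA EB W κ θ' C₅ := by
  obtain ⟨hh, hs⟩ := (rateWindow_nonempty_iff hω1 hc hG).2 h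
  obtain ⟨θ', h1, h2⟩ := exists_between (max_lt hθ1 hs)
  exact ⟨θ', h2, (le_max_left _ _).trans h1.le, exists_ne5_of_familySlots_reIm_termwise_lip S Out₀ hrot hrA hrB hbase hbox
    hrep hbd hbud hline hdA hdB hop hins hdamp hG hδ hδ' hθ0 hθ1 ((le_max_left _ _).trans h1.le) h2.le hc hω hω1 hh
    ((le_max_right _ _).trans_lt h1) ι₀ hιA hιB⟩

end ComplexChart

end Summit.QuantumFields.BalabanUV.T4Continuum.OutputRateFunctionalTablesTermwiseArithmetic

end
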